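import Mathlib

/-!
# Crux `PeriodicWindows` (stmt-AtomisticToContinuum-3240), line `Sketch`:
# stub `stub_levelRegistry`, part A

Helper lemmas for stub E0b2 `stub_levelRegistry` of the lead skeleton `PeriodicWindowsSketch`
(exact inter-level rigidity of a layered point set in `ℝ³`); pure Euclidean/lattice geometry.

* A1. Coordinates of `ℝ³` and the algebra of a triangular frame `(e, f)` of spacing `a`
  (`‖e‖ = ‖f‖ = a`, `⟪e, f⟫ = a²/2`): `‖αe + βf‖² = a²(α² + αβ + β²)`, the inner product of two
  combinations, unit lattice vectors have `i² + ij + j² = 1`, and the planar non-degeneracy of the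
  frame in coordinates.
* A2. Finite checks on the form `i² + ij + j²` (by `interval_cases`): the centroid class of a unit
  lattice triangle is `≢ 0 (mod 3)` with equal coordinate residues; `M² + MN + N² = 9` forces
  `3 ∣ M, N`; two unit vectors with inner product `a²/2` are a unimodular pair with equal nonzero
  coordinate-sum residues; choice of the hole sign.
* A3. Three lattice points on a small circle: two distinct points of one level lattice at distance
  `b ≤ 1` from a point `|g| ≥ 19/25` below are at distance exactly `a` (the chord is
  `≤ 2√(b² − g²) < √2·a ≤ √(i² + ij + j²)·a` unless the form is `1`), so three such points are a
  unit triangle; a coplanar point equidistant from its vertices is the centroid, whence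
  `g² = b² − a²/3` and `t₁ + t₂ + t₃ = 3y + 3g e₃`.
-/

noncomputable section

namespace Summit.AtomisticToContinuum.Crystallization.Theorems.PeriodicWindowsSketch

/-! ## Part A1: coordinates and frame algebra in `ℝ³` -/

/-- The squared distance of `ℝ³` in coordinates. -/
theorem lreg_dist_sq_fin3 (x y : EuclideanSpace ℝ (Fin 3)) :
    dist x y ^ 2 = (x 0 - y 0) ^ 2 + (x 1 - y 1) ^ 2 + (x 2 - y 2) ^ 2 := by
  rw [EuclideanSpace.dist_sq_eq, Fin.sum_univ_three, Real.dist_eq, Real.dist_eq, Real.dist_eq,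
    sq_abs, sq_abs, sq_abs]

/-- Squared norm of a real combination `α e + β f` of a triangular frame of spacing `a`
(`‖e‖ = ‖f‖ = a`, `⟪e, f⟫ = a²/2`): `a² (α² + αβ + β²)`. -/
theorem lreg_norm_sq_comb {a : ℝ} {e f : EuclideanSpace ℝ (Fin 3)} (he : ‖e‖ = a) (hf : ‖f‖ = a)
    (hef : inner ℝ e f = a ^ 2 / 2) (α β : ℝ) :
    ‖α • e + β • f‖ ^ 2 = a ^ 2 * (α ^ 2 + α * β + β ^ 2) := by
  rw [norm_add_sq_real, norm_smul, norm_smul, real_inner_smul_left, real_inner_smul_right, hef,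
    mul_pow, mul_pow, he, hf, Real.norm_eq_abs, Real.norm_eq_abs, sq_abs, sq_abs]
  ring

/-- Inner product of two real combinations of a triangular frame of spacing `a`. -/
theorem lreg_inner_comb {a : ℝ} {e f : EuclideanSpace ℝ (Fin 3)} (he : ‖e‖ = a) (hf : ‖f‖ = a)
    (hef : inner ℝ e f = a ^ 2 / 2) (α β γ δ : ℝ) :
    inner ℝ (α • e + β • f) (γ • e + δ • f) = a ^ 2 * (α * γ + (α * δ + β * γ) / 2 + β * δ) := by
  have hfe : inner ℝ f e = a ^ 2 / 2 := by rw [real_inner_comm]; exact hef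
  simp only [inner_add_left, inner_add_right, real_inner_smul_left, real_inner_smul_right, hef, hfe,
    real_inner_self_eq_norm_sq, he, hf]
  ring

/-- An integer frame vector `i e + j f` of norm `a` (the spacing) has `i² + ij + j² = 1`. -/
theorem lreg_form_eq_one {a : ℝ} (ha : 0 < a) {e f : EuclideanSpace ℝ (Fin 3)} (he : ‖e‖ = a)
    (hf : ‖f‖ = a) (hef : inner ℝ e f = a ^ 2 / 2) {i j : ℤ}
    (h : ‖(i : ℝ) • e + (j : ℝ) • f‖ = a) : i ^ 2 + i * j + j ^ 2 = 1 := by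
  have h2 := lreg_norm_sq_comb he hf hef (i : ℝ) (j : ℝ)
  rw [h] at h2
  have h3 : ((i : ℝ) ^ 2 + i * j + (j : ℝ) ^ 2) = 1 :=
    ((mul_right_inj' (pow_ne_zero 2 ha.ne')).1 (by rw [mul_one]; exact h2)).symm
  exact_mod_cast h3

/-- A lattice step of length `a`: if `t' = t + i e + j f` and `dist t t' = a` then
`i² + ij + j² = 1`. -/
theorem lreg_form_of_dist {a : ℝ} (ha : 0 < a) {e f : EuclideanSpace ℝ (Fin 3)} (he : ‖e‖ = a)
    (hf : ‖f‖ = a) (hef : inner ℝ e f = a ^ 2 / 2) {t t' : EuclideanSpace ℝ (Fin 3)} {i j : ℤ}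
    (h : t' = t + (i : ℝ) • e + (j : ℝ) • f) (hd : dist t t' = a) : i ^ 2 + i * j + j ^ 2 = 1 := by
  rw [dist_comm, dist_eq_norm, h, add_assoc, add_sub_cancel_left] at hd
  exact lreg_form_eq_one ha he hf hef hd

/-- Planar non-degeneracy of a triangular frame, in coordinates: a plane vector orthogonal to
two vectors of length `a > 0` making inner product `a²/2` vanishes. -/
theorem lreg_scalar_perp {a s0 s1 e0 e1 f0 f1 : ℝ} (ha : 0 < a) (hee : e0 ^ 2 + e1 ^ 2 = a ^ 2)
    (hff : f0 ^ 2 + f1 ^ 2 = a ^ 2) (hef : e0 * f0 + e1 * f1 = a ^ 2 / 2)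
    (hse : s0 * e0 + s1 * e1 = 0) (hsf : s0 * f0 + s1 * f1 = 0) : s0 = 0 ∧ s1 = 0 := by
  have hdet : (e0 * f1 - e1 * f0) ^ 2 = 3 / 4 * a ^ 4 := by nlinarith [hee, hff, hef]
  have hD : e0 * f1 - e1 * f0 ≠ 0 := by
    intro h0; rw [h0] at hdet; nlinarith [pow_pos ha 4]
  have h0 : s0 * (e0 * f1 - e1 * f0) = 0 := by linear_combination f1 * hse - e1 * hsf
  have h1 : s1 * (e0 * f1 - e1 * f0) = 0 := by linear_combination (-f0) * hse + e0 * hsf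
  exact ⟨(mul_eq_zero.1 h0).resolve_right hD, (mul_eq_zero.1 h1).resolve_right hD⟩

/-! ## Part A2: integer lemmas on the form `i² + ij + j²` -/

/-- The centroid class of a unit lattice triangle `{0, (i, j), (i', j')}` (frame coordinates):
the coordinate sums are congruent and nonzero modulo `3` (an 81-case check). -/
theorem lreg_centroid_class {i j i' j' : ℤ} (h1 : i ^ 2 + i * j + j ^ 2 = 1)
    (h2 : i' ^ 2 + i' * j' + j' ^ 2 = 1)
    (h3 : (i' - i) ^ 2 + (i' - i) * (j' - j) + (j' - j) ^ 2 = 1) :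
    (i + i') % 3 = (j + j') % 3 ∧ (i + i') % 3 ≠ 0 := by
  have hi : -1 ≤ i ∧ i ≤ 1 := by
    constructor <;> nlinarith [sq_nonneg (2 * j + i), sq_nonneg (i - 1), sq_nonneg (i + 1)]
  have hj : -1 ≤ j ∧ j ≤ 1 := by
    constructor <;> nlinarith [sq_nonneg (2 * i + j), sq_nonneg (j - 1), sq_nonneg (j + 1)]
  have hi' : -1 ≤ i' ∧ i' ≤ 1 := by
    constructor <;> nlinarith [sq_nonneg (2 * j' + i'), sq_nonneg (i' - 1), sq_nonneg (i' + 1)]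
  have hj' : -1 ≤ j' ∧ j' ≤ 1 := by
    constructor <;> nlinarith [sq_nonneg (2 * i' + j'), sq_nonneg (j' - 1), sq_nonneg (j' + 1)]
  obtain ⟨hi1, hi2⟩ := hi
  obtain ⟨hj1, hj2⟩ := hj
  obtain ⟨hi'1, hi'2⟩ := hi'
  obtain ⟨hj'1, hj'2⟩ := hj'
  interval_cases i <;> interval_cases j <;> interval_cases i' <;> interval_cases j' <;> omega

/-- The frame vectors of squared form `9` are the triples of the unit ones: `M² + MN + N² = 9`
forces `3 ∣ M` and `3 ∣ N` (a 49-case check). -/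
theorem lreg_nine {M N : ℤ} (h : M ^ 2 + M * N + N ^ 2 = 9) : M % 3 = 0 ∧ N % 3 = 0 := by
  have hM : -3 ≤ M ∧ M ≤ 3 := by
    constructor <;> nlinarith [sq_nonneg (2 * N + M), sq_nonneg (M - 3), sq_nonneg (M + 3)]
  have hN : -3 ≤ N ∧ N ≤ 3 := by
    constructor <;> nlinarith [sq_nonneg (2 * M + N), sq_nonneg (N - 3), sq_nonneg (N + 3)]
  obtain ⟨hM1, hM2⟩ := hM
  obtain ⟨hN1, hN2⟩ := hN
  interval_cases M <;> interval_cases N <;> omega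

/-- Two unit frame vectors `(I, J)`, `(I', J')` (frame coordinates) with inner product `a²/2`,
i.e. `2II' + IJ' + JI' + 2JJ' = 1`, form a unimodular pair whose coordinate sums are congruent
and nonzero modulo `3` (an 81-case check). -/
theorem lreg_sigma_det {I J I' J' : ℤ} (h1 : I ^ 2 + I * J + J ^ 2 = 1)
    (h2 : I' ^ 2 + I' * J' + J' ^ 2 = 1) (h3 : 2 * (I * I') + I * J' + J * I' + 2 * (J * J') = 1) :
    (I * J' - J * I' = 1 ∨ I * J' - J * I' = -1) ∧ (I + I') % 3 = (J + J') % 3 ∧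
      (I + I') % 3 ≠ 0 := by
  have hi : -1 ≤ I ∧ I ≤ 1 := by
    constructor <;> nlinarith [sq_nonneg (2 * J + I), sq_nonneg (I - 1), sq_nonneg (I + 1)]
  have hj : -1 ≤ J ∧ J ≤ 1 := by
    constructor <;> nlinarith [sq_nonneg (2 * I + J), sq_nonneg (J - 1), sq_nonneg (J + 1)]
  have hi' : -1 ≤ I' ∧ I' ≤ 1 := by
    constructor <;> nlinarith [sq_nonneg (2 * J' + I'), sq_nonneg (I' - 1), sq_nonneg (I' + 1)]
  have hj' : -1 ≤ J' ∧ J' ≤ 1 := by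
    constructor <;> nlinarith [sq_nonneg (2 * I' + J'), sq_nonneg (J' - 1), sq_nonneg (J' + 1)]
  obtain ⟨hi1, hi2⟩ := hi
  obtain ⟨hj1, hj2⟩ := hj
  obtain ⟨hi'1, hi'2⟩ := hi'
  obtain ⟨hj'1, hj'2⟩ := hj'
  interval_cases I <;> interval_cases J <;> interval_cases I' <;> interval_cases J' <;> omega

/-- Choice of the hole sign: if `m ≡ n ≢ 0` and `A ≡ B ≢ 0 (mod 3)` then for some sign `σ`
both `m + σA` and `n + σB` are divisible by `3`. -/
theorem lreg_choose_sign {m n A B : ℤ} (hmn : m % 3 = n % 3) (hm : m % 3 ≠ 0)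
    (hAB : A % 3 = B % 3) (hA : A % 3 ≠ 0) :
    ∃ σ : ℤ, (σ = 1 ∨ σ = -1) ∧ 3 ∣ m + σ * A ∧ 3 ∣ n + σ * B := by
  rcases (by omega : m % 3 = 1 ∨ m % 3 = 2) with h | h <;>
    rcases (by omega : A % 3 = 1 ∨ A % 3 = 2) with h' | h'
  · exact ⟨-1, Or.inr rfl, by omega, by omega⟩
  · exact ⟨1, Or.inl rfl, by omega, by omega⟩
  · exact ⟨1, Or.inl rfl, by omega, by omega⟩
  · exact ⟨-1, Or.inr rfl, by omega, by omega⟩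

/-! ## Part A3: three lattice points on a small circle -/

/-- Two distinct points `t, t' = t + i e + j f` of one level, both at distance `b ≤ 1` from a
point `y` lying `|g| ≥ 19/25` below/above that level, are at distance exactly `a`: the chord is
`≤ 2√(b² − g²) < √2 · a`, and squared level distances are `a² (i² + ij + j²)`. -/
theorem lreg_side {a b g : ℝ} (ha1 : 19 / 20 ≤ a) (hb2 : b ≤ 1) (hg : 19 / 25 ≤ |g|)
    {e f : EuclideanSpace ℝ (Fin 3)} (he : ‖e‖ = a) (hf : ‖f‖ = a)
    (hef : inner ℝ e f = a ^ 2 / 2) {y t t' : EuclideanSpace ℝ (Fin 3)} (ht : t 2 = y 2 + g)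
    (ht' : t' 2 = y 2 + g) (hd : dist y t = b) (hd' : dist y t' = b) (hne : t ≠ t') {i j : ℤ}
    (htt' : t' = t + (i : ℝ) • e + (j : ℝ) • f) :
    i ^ 2 + i * j + j ^ 2 = 1 ∧ dist t t' = a := by
  have hsq : dist t t' ^ 2 = a ^ 2 * ((i : ℝ) ^ 2 + i * j + (j : ℝ) ^ 2) := by
    rw [dist_comm, dist_eq_norm, htt', add_assoc, add_sub_cancel_left]
    exact lreg_norm_sq_comb he hf hef i j
  have hb0 : 0 ≤ b := hd ▸ dist_nonneg
  have hup : dist t t' ^ 2 ≤ 4 * (b ^ 2 - g ^ 2) := by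
    have h1 := lreg_dist_sq_fin3 y t
    have h2 := lreg_dist_sq_fin3 y t'
    have h3 := lreg_dist_sq_fin3 t t'
    rw [hd, ht] at h1
    rw [hd', ht'] at h2
    rw [ht, ht'] at h3
    nlinarith [sq_nonneg (t 0 + t' 0 - 2 * y 0), sq_nonneg (t 1 + t' 1 - 2 * y 1)]
  have hg2 : (19 / 25 : ℝ) ^ 2 ≤ g ^ 2 := by
    rw [← sq_abs g]; exact pow_le_pow_left₀ (by norm_num) hg 2
  have hform_lt : ((i : ℝ) ^ 2 + i * j + (j : ℝ) ^ 2) < 2 := by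
    by_contra hcon
    rw [not_lt] at hcon
    have h2a : a ^ 2 * 2 ≤ dist t t' ^ 2 := by
      rw [hsq]; exact mul_le_mul_of_nonneg_left hcon (sq_nonneg a)
    nlinarith
  have hn2 : i ^ 2 + i * j + j ^ 2 < 2 := by exact_mod_cast hform_lt
  have hn0 : i ^ 2 + i * j + j ^ 2 ≠ 0 := by
    intro h0
    have hj0 : j = 0 := by
      have : j ^ 2 = 0 := by nlinarith [sq_nonneg (2 * i + j), sq_nonneg j]
      exact (pow_eq_zero_iff two_ne_zero).1 this
    subst hj0
    have hi0 : i = 0 := by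
      have : i ^ 2 = 0 := by nlinarith
      exact (pow_eq_zero_iff two_ne_zero).1 this
    subst hi0
    exact hne (by rw [htt']; simp)
  have hnn : 0 ≤ i ^ 2 + i * j + j ^ 2 := by nlinarith [sq_nonneg (2 * i + j), sq_nonneg j]
  have hn1 : i ^ 2 + i * j + j ^ 2 = 1 := by
    generalize i ^ 2 + i * j + j ^ 2 = n at *
    omega
  refine ⟨hn1, ?_⟩
  have hcast : ((i : ℝ) ^ 2 + i * j + (j : ℝ) ^ 2) = 1 := by exact_mod_cast hn1
  rw [hcast, mul_one] at hsq
  exact (sq_eq_sq₀ dist_nonneg (by linarith)).1 hsq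

/-- **Three lattice points on a small circle.** Three distinct points `t₁, t₂ = t₁ + i₂e + j₂f,
t₃ = t₁ + i₃e + j₃f` of one level at common distance `b ≤ 1` from a point `y` lying
`|g| ≥ 19/25` below/above the level form a unit lattice triangle (pairwise distance `a`, unit
steps), `y + g e₃` is its centroid, and `g² = b² − a²/3`. -/
theorem lreg_triangle {a b g : ℝ} (ha1 : 19 / 20 ≤ a) (hb2 : b ≤ 1) (hg : 19 / 25 ≤ |g|)
    {e f : EuclideanSpace ℝ (Fin 3)} (he : ‖e‖ = a) (hf : ‖f‖ = a)
    (hef : inner ℝ e f = a ^ 2 / 2) {y t₁ t₂ t₃ : EuclideanSpace ℝ (Fin 3)}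
    (h₁ : t₁ 2 = y 2 + g) (h₂ : t₂ 2 = y 2 + g) (h₃ : t₃ 2 = y 2 + g)
    (d₁ : dist y t₁ = b) (d₂ : dist y t₂ = b) (d₃ : dist y t₃ = b)
    (h₁₂ : t₁ ≠ t₂) (h₁₃ : t₁ ≠ t₃) (h₂₃ : t₂ ≠ t₃) {i₂ j₂ i₃ j₃ : ℤ}
    (ht₂ : t₂ = t₁ + (i₂ : ℝ) • e + (j₂ : ℝ) • f) (ht₃ : t₃ = t₁ + (i₃ : ℝ) • e + (j₃ : ℝ) • f) :
    (i₂ ^ 2 + i₂ * j₂ + j₂ ^ 2 = 1 ∧ i₃ ^ 2 + i₃ * j₃ + j₃ ^ 2 = 1 ∧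
      (i₃ - i₂) ^ 2 + (i₃ - i₂) * (j₃ - j₂) + (j₃ - j₂) ^ 2 = 1) ∧
    (dist t₁ t₂ = a ∧ dist t₁ t₃ = a ∧ dist t₂ t₃ = a) ∧
    g ^ 2 = b ^ 2 - a ^ 2 / 3 ∧
    t₁ + t₂ + t₃ = (3 : ℝ) • y + (3 * g) • EuclideanSpace.single (2 : Fin 3) (1 : ℝ) := by
  obtain ⟨n₂, e₁₂⟩ := lreg_side ha1 hb2 hg he hf hef h₁ h₂ d₁ d₂ h₁₂ ht₂
  obtain ⟨n₃, e₁₃⟩ := lreg_side ha1 hb2 hg he hf hef h₁ h₃ d₁ d₃ h₁₃ ht₃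
  have ht₃' : t₃ = t₂ + ((i₃ - i₂ : ℤ) : ℝ) • e + ((j₃ - j₂ : ℤ) : ℝ) • f := by
    rw [ht₃, ht₂]; push_cast; module
  obtain ⟨n₂₃, e₂₃⟩ := lreg_side ha1 hb2 hg he hf hef h₂ h₃ d₂ d₃ h₂₃ ht₃'
  refine ⟨⟨n₂, n₃, n₂₃⟩, ⟨e₁₂, e₁₃, e₂₃⟩, ?_⟩
  have ha : 0 < a := by linarith
  -- the six scalar equations in the coordinates `0, 1`
  have E1 := lreg_dist_sq_fin3 y t₁
  have E2 := lreg_dist_sq_fin3 y t₂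
  have E3 := lreg_dist_sq_fin3 y t₃
  have E12 := lreg_dist_sq_fin3 t₁ t₂
  have E13 := lreg_dist_sq_fin3 t₁ t₃
  have E23 := lreg_dist_sq_fin3 t₂ t₃
  rw [d₁, h₁] at E1
  rw [d₂, h₂] at E2
  rw [d₃, h₃] at E3
  rw [e₁₂, h₁, h₂] at E12
  rw [e₁₃, h₁, h₃] at E13
  rw [e₂₃, h₂, h₃] at E23
  -- the centroid: `S = Σ (tₖ - y)` is horizontal and orthogonal to two sides
  obtain ⟨hS0, hS1⟩ := lreg_scalar_perp (a := a) (s0 := t₁ 0 + t₂ 0 + t₃ 0 - 3 * y 0)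
    (s1 := t₁ 1 + t₂ 1 + t₃ 1 - 3 * y 1) (e0 := t₁ 0 - t₂ 0) (e1 := t₁ 1 - t₂ 1)
    (f0 := t₁ 0 - t₃ 0) (f1 := t₁ 1 - t₃ 1) ha (by linear_combination -E12)
    (by linear_combination -E13)
    (by linear_combination (-1 / 2 : ℝ) * E12 - (1 / 2) * E13 + (1 / 2) * E23)
    (by linear_combination (-3 / 2 : ℝ) * E1 + (3 / 2) * E2 + (1 / 2) * E13 - (1 / 2) * E23)
    (by linear_combination (-3 / 2 : ℝ) * E1 + (3 / 2) * E3 + (1 / 2) * E12 - (1 / 2) * E23)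
  have hSS : (t₁ 0 + t₂ 0 + t₃ 0 - 3 * y 0) ^ 2 + (t₁ 1 + t₂ 1 + t₃ 1 - 3 * y 1) ^ 2 = 0 := by
    rw [hS0, hS1]; norm_num
  constructor
  · linear_combination (-1 / 3 : ℝ) * (E1 + E2 + E3) + (1 / 9) * (E12 + E13 + E23) -
      (1 / 9) * hSS
  · ext k
    fin_cases k
    · simp; linarith
    · simp; linarith
    · simp [h₁, h₂, h₃]; ring

end Summit.AtomisticToContinuum.Crystallization.Theorems.PeriodicWindowsSketch
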